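import Mathlib
import Summits.ABC.ABC.Theses.ThreeSlotCyclotomicDescent
import Literature.NumberTheory.DiophantineGeometry.ClassicalPellPowerFacts
import Literature.NumberTheory.DiophantineGeometry.GeneralizedFermatSignatureNN2
import Literature.NumberTheory.DiophantineGeometry.GeneralizedFermatSignatureNN3
import Summits.ABC.ABC.Theorems.ThreeSlotL4Empty
import Summits.ABC.ABC.Theorems.SolvedZooCohnOddExponent
import Summits.ABC.ABC.Theorems.SolvedZooL3Reduction
import Summits.ABC.ABC.Theorems.SolvedZooL1Consumer
import Summits.ABC.ABC.Theorems.SolvedZooL2Consumer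
import Summits.ABC.ABC.Theorems.SolvedZooL3Consumer

/-!
# ASSEMBLY-MOD-FACTS: `SolvedZooABC` (stmt-ABC-24025) ⇐ five named facts — kernel-checked IMPLICATION only

`route-ABC-ThreeSlotCyclotomicDescent`, crux `SolvedZooABC` (stmt-ABC-24025): abc(ε) with a constant
`C(ε)` on the four solved-in-print families L1–L4 of the three-prime zoo (each ∨ its (a,b)-swap).
This file proves ONE assembly theorem, `solvedZooABC_of_facts`, whose binders are EXACTLY the
remaining inputs of 24025 — five NAMED FACTS of the tree, BY NAME, nothing inline, nothing re-typed —
and whose conclusion is the route decl `Summit.ABC.ABC.Theses.ThreeSlotCyclotomicDescent.SolvedZooABC`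
BY NAME:

| binder | named fact (tree) | print theorem | closes |
|---|---|---|---|
| `hF1` | `Literature.NumberTheory.DiophantineGeometry.ljunggren1942_sqPlusOneEqTwiceFourth` | [Ljunggren1942] `x² + 1 = 2y⁴` | L2 (with Cohn 1996 odd half, a THEOREM: `cohn1996_lemma_odd`, ★ p609304) |
| `hF2` | `Literature.NumberTheory.DiophantineGeometry.ljunggren1943_geomSumEqSquare` | [Ljunggren1943] `(xⁿ−1)/(x−1) = y²` | L3 |
| `hF3` | `Literature.NumberTheory.DiophantineGeometry.le2002_sqPlusPow2EqPow` | [Le2002] (Cohn 1992 / Arif–Abu Muriefah 2001) `x² + 2^k = yⁿ` | L1 |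
| `h₂` | `Literature.NumberTheory.DiophantineGeometry.darmonMerel1997_sumOfPowersEqSquare` | [DarmonMerel1997] Main Thm (2) | L4 |
| `h₃` | `Literature.NumberTheory.DiophantineGeometry.darmonMerel1997_sumOfPowersEqCube` | [DarmonMerel1997] Main Thm (3) (printed under modularity) | L4 |

Composition: `SolvedZooL1Consumer.solvedZoo_L1_of hF3` (L1 = {(4,121,125)} ∪ swap),
`SolvedZooL2Consumer.solvedZoo_L2_of cohn1996_lemma_odd (quartic_of_ljunggren1942 hF1)`
(L2 = {(1,57121,57122)} ∪ swap), `SolvedZooL3Consumer.solvedZoo_L3_of (geomSum_of_ljunggren1943 hF2)`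
(L3 = {(1,242,243)} ∪ swap), `ThreeSlotL4Empty.solvedZoo_L4 h₂ h₃` (★ p594001; L4 = ∅); constant
`C = max (max C₁ C₂) (max C₃ C₄)` (each family file gives `C = 10`, L4 gives `1`). The two small
adapters `quartic_of_ljunggren1942`, `geomSum_of_ljunggren1943` discharge the idle printed side
conditions (`0 < x`, `0 < y`; `1 < y`) of F1/F2 against the consumer files' hypothesis shapes.

LABEL (desk abc-harv-plan, 2026-08-28T05:52:56Z / 06:27:27Z): «ASSEMBLY-MOD-FACTS: SolvedZooABC
(24025) ⇐ {Ljunggren 1942, Ljunggren 1943, Le 2002, Darmon–Merel (2), Darmon–Merel (3)} —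
kernel-checked IMPLICATION only; 24025 NOT closed; facts remaining n = 5 (all named, 0 raw binders;
Cohn 1996 odd half is a theorem, ★ p609304); NOT abc, NOT A-PS; zoo class line at abc distance 0».
PROVED-MOD-FACTS ≠ proved; typed ≠ proved; abc moved by 0.
-/

namespace Summit.ABC.ABC.Theorems.SolvedZooAssemblyModFacts

open Literature.NumberTheory.DiophantineGeometry (IsABCTriple rad
  ljunggren1942_sqPlusOneEqTwiceFourth ljunggren1943_geomSumEqSquare le2002_sqPlusPow2EqPow
  darmonMerel1997_sumOfPowersEqSquare darmonMerel1997_sumOfPowersEqCube)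
open Summit.ABC.ABC.Theses.ThreeSlotCyclotomicDescent (SolvedZooABC)
open Summit.ABC.ABC.Theorems.ThreeSlotL4Empty (solvedZoo_L4)
open Summit.ABC.ABC.Theorems.SolvedZooL3Reduction (three_terms_le_geom_sum)
open Summit.ABC.ABC.Theorems.SolvedZooL1Consumer (solvedZoo_L1_of)
open Summit.ABC.ABC.Theorems.SolvedZooL2Consumer (solvedZoo_L2_of)
open Summit.ABC.ABC.Theorems.SolvedZooL3Consumer (solvedZoo_L3_of)

/-- Adapter: the named fact [Ljunggren1942] (`ljunggren1942_sqPlusOneEqTwiceFourth`, with its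
printed positivity side conditions) gives the hypothesis shape of `SolvedZooL2Consumer`
(`x² + 1 = 2t⁴ ⇒ t = 1 ∨ t = 13`): `x = 0` and `t = 0` are excluded by parity / positivity. -/
theorem quartic_of_ljunggren1942 (h : ljunggren1942_sqPlusOneEqTwiceFourth) (x t : ℕ)
    (hxt : x ^ 2 + 1 = 2 * t ^ 4) : t = 1 ∨ t = 13 := by
  have hx : 0 < x := by
    refine Nat.pos_of_ne_zero ?_
    rintro rfl
    rw [zero_pow two_ne_zero, zero_add] at hxt
    omega
  have ht : 0 < t := by
    refine Nat.pos_of_ne_zero ?_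
    rintro rfl
    rw [zero_pow four_ne_zero, mul_zero] at hxt
    omega
  rcases h x t hx ht hxt with ⟨-, h1⟩ | ⟨-, h13⟩
  · exact Or.inl h1
  · exact Or.inr h13

/-- Adapter: the named fact [Ljunggren1943] (`ljunggren1943_geomSumEqSquare`, with its printed side
condition `1 < y`) gives the hypothesis shape of `SolvedZooL3Consumer`: for `1 < x`, `2 < n` the
geometric sum is `≥ 1 + x + x² ≥ 7`, so `y ≥ 2` automatically. -/
theorem geomSum_of_ljunggren1943 (h : ljunggren1943_geomSumEqSquare) (x n y : ℕ) (hx : 1 < x)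
    (hn : 2 < n) (hs : (Finset.range n).sum (fun i => x ^ i) = y ^ 2) :
    (x, n, y) = (3, 5, 11) ∨ (x, n, y) = (7, 4, 20) := by
  have h3 : 1 + x + x ^ 2 ≤ (Finset.range n).sum (fun i => x ^ i) :=
    three_terms_le_geom_sum x (by omega)
  have hy : 1 < y := by
    refine lt_of_not_ge fun hy1 => ?_
    have hy2 : y ^ 2 ≤ 1 ^ 2 := Nat.pow_le_pow_left hy1 2
    rw [one_pow] at hy2
    have hx2 : x ≤ x ^ 2 := Nat.le_self_pow two_ne_zero x
    omega
  rcases h x n y hx hn hy hs with ⟨rfl, rfl, rfl⟩ | ⟨rfl, rfl, rfl⟩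
  · exact Or.inl rfl
  · exact Or.inr rfl

/-- **ASSEMBLY-MOD-FACTS for `SolvedZooABC` (stmt-ABC-24025).** The crux follows from the five
named facts of the tree, BY NAME: [Ljunggren1942] (`hF1`, closes L2 together with the THEOREM
`cohn1996_lemma_odd`), [Ljunggren1943] (`hF2`, closes L3), [Le2002] (`hF3`, closes L1),
[DarmonMerel1997, Main Theorem (2)] (`h₂`) and Main Theorem (3) (`h₃`) (close L4). Kernel-checked
IMPLICATION only: 24025 is NOT closed by this theorem (facts remaining n = 5); PROVED-MOD-FACTS ≠
proved; not abc, abc moved by 0. -/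
theorem solvedZooABC_of_facts (hF1 : ljunggren1942_sqPlusOneEqTwiceFourth)
    (hF2 : ljunggren1943_geomSumEqSquare) (hF3 : le2002_sqPlusPow2EqPow)
    (h₂ : darmonMerel1997_sumOfPowersEqSquare) (h₃ : darmonMerel1997_sumOfPowersEqCube) :
    SolvedZooABC := by
  unfold SolvedZooABC
  intro ε hε
  obtain ⟨C₁, hC₁, H1⟩ := solvedZoo_L1_of hF3 ε hε
  obtain ⟨C₂, hC₂, H2⟩ :=
    solvedZoo_L2_of cohn1996_lemma_odd (quartic_of_ljunggren1942 hF1) ε hε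
  obtain ⟨C₃, hC₃, H3⟩ := solvedZoo_L3_of (geomSum_of_ljunggren1943 hF2) ε hε
  obtain ⟨C₄, hC₄, H4⟩ := solvedZoo_L4 h₂ h₃ ε hε
  refine ⟨max (max C₁ C₂) (max C₃ C₄), lt_max_of_lt_left (lt_max_of_lt_left hC₁), ?_⟩
  intro a b c ht hfam
  have hr : (0 : ℝ) ≤ ((rad a b c : ℕ) : ℝ) ^ (1 + ε) := Real.rpow_nonneg (Nat.cast_nonneg _) _
  rcases hfam with (h1 | h2 | h3 | h4) | (h1 | h2 | h3 | h4)
  · exact (H1 a b c ht (Or.inl h1)).trans_le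
      (mul_le_mul_of_nonneg_right ((le_max_left _ _).trans (le_max_left _ _)) hr)
  · exact (H2 a b c ht (Or.inl h2)).trans_le
      (mul_le_mul_of_nonneg_right ((le_max_right _ _).trans (le_max_left _ _)) hr)
  · exact (H3 a b c ht (Or.inl h3)).trans_le
      (mul_le_mul_of_nonneg_right ((le_max_left _ _).trans (le_max_right _ _)) hr)
  · exact (H4 a b c ht (Or.inl h4)).trans_le
      (mul_le_mul_of_nonneg_right ((le_max_right _ _).trans (le_max_right _ _)) hr)
  · exact (H1 a b c ht (Or.inr h1)).trans_le
      (mul_le_mul_of_nonneg_right ((le_max_left _ _).trans (le_max_left _ _)) hr)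
  · exact (H2 a b c ht (Or.inr h2)).trans_le
      (mul_le_mul_of_nonneg_right ((le_max_right _ _).trans (le_max_left _ _)) hr)
  · exact (H3 a b c ht (Or.inr h3)).trans_le
      (mul_le_mul_of_nonneg_right ((le_max_left _ _).trans (le_max_right _ _)) hr)
  · exact (H4 a b c ht (Or.inr h4)).trans_le
      (mul_le_mul_of_nonneg_right ((le_max_right _ _).trans (le_max_right _ _)) hr)

/-- **L2 conjunct of `SolvedZooABC` BY NAME** (follow-up of `SolvedZooL2Consumer.solvedZoo_L2_of`,
whose Ljunggren-1942 hypothesis was stated inline): family (ii) ∨ swap in abc(ε) form, modulo the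
ONE named fact [Ljunggren1942] `ljunggren1942_sqPlusOneEqTwiceFourth` (the Cohn 1996 odd half is
the theorem `cohn1996_lemma_odd`, ★ p609304). PROVED-MOD-FACT {Ljunggren 1942} ≠ proved;
not abc. -/
theorem solvedZoo_L2_of_facts (hF1 : ljunggren1942_sqPlusOneEqTwiceFourth) :
    ∀ ε : ℝ, 0 < ε → ∃ C : ℝ, 0 < C ∧ ∀ a b c : ℕ, IsABCTriple a b c →
      ((∃ u p r z : ℕ, p.Prime ∧ r.Prime ∧ 1 ≤ u ∧ 4 ≤ z ∧ Even z ∧ a = 1 ∧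
          b = p ^ (2 * u) ∧ c = 2 * r ^ z) ∨
       (∃ u p r z : ℕ, p.Prime ∧ r.Prime ∧ 1 ≤ u ∧ 4 ≤ z ∧ Even z ∧ b = 1 ∧
          a = p ^ (2 * u) ∧ c = 2 * r ^ z)) →
      (c : ℝ) < C * ((rad a b c : ℕ) : ℝ) ^ (1 + ε) :=
  solvedZoo_L2_of cohn1996_lemma_odd (quartic_of_ljunggren1942 hF1)

/-- **L3 conjunct of `SolvedZooABC` BY NAME** (follow-up of `SolvedZooL3Consumer.solvedZoo_L3_of`,
whose Ljunggren-1943 hypothesis was stated inline): family (iii) ∨ swap in abc(ε) form, modulo the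
ONE named fact [Ljunggren1943] `ljunggren1943_geomSumEqSquare`. PROVED-MOD-FACT {Ljunggren 1943}
≠ proved; not abc. -/
theorem solvedZoo_L3_of_facts (hF2 : ljunggren1943_geomSumEqSquare) :
    ∀ ε : ℝ, 0 < ε → ∃ C : ℝ, 0 < C ∧ ∀ a b c : ℕ, IsABCTriple a b c →
      ((∃ x q r z : ℕ, q.Prime ∧ r.Prime ∧ Odd r ∧ Odd z ∧ 3 ≤ z ∧ a = 1 ∧
          b = 2 ^ x * q ^ 2 ∧ c = r ^ z) ∨
       (∃ x q r z : ℕ, q.Prime ∧ r.Prime ∧ Odd r ∧ Odd z ∧ 3 ≤ z ∧ b = 1 ∧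
          a = 2 ^ x * q ^ 2 ∧ c = r ^ z)) →
      (c : ℝ) < C * ((rad a b c : ℕ) : ℝ) ^ (1 + ε) :=
  solvedZoo_L3_of (geomSum_of_ljunggren1943 hF2)

end Summit.ABC.ABC.Theorems.SolvedZooAssemblyModFacts
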